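import Summits.ABC.IUTFork.LDHGenuinePerImageExplicit
import Summits.ABC.IUTFork.LDHGenuineStepVBound
import Literature.IUT.LogVolume.GenuineTowerFacts
import Literature.IUT.LogVolume.GenuineLogThetaTowerArith
import Literature.IUT.LogVolume.GenuineSupportPrimesBound
import Literature.IUT.LogVolume.Theorem110TowerBridge
import Literature.IUT.LogVolume.DistinguishedPrimesBoundTower
import Literature.IUT.LogVolume.DifferentOrdGaloisFibre
import HarnessLib

/-!
# The fork at [IUTchIII] Corollary 3.12, L-DH level, READING (P): S-b (TOWER ARITHMETIC) AT THE GENUINE DATUM —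
# `HullEstimatePerImageOf T (B_III P l)` for EVERY datum, modulo the (R4)-shape e-term input ONLY
# (abc-iut cell, crux ThetaPartII = stmt-ABC-19678, union skeleton 76b99b29aaa7c8f6, stub `stub_hullVolumePerImage` (ii′-P))

Record-only file (D-0012) of the abc-iut cell (WAVE-3 discharge seat abc-iut-c312-d1, gen 5); TAKES NO SIDE on
[IUTchIII] Cor. 3.12. Mochizuki, *Inter-universal Teichmüller theory IV* (RIMS manuscript Apr. 2020 = PRIMS **57**
(2021)), Thm. 1.10 proof Steps (ii) p. 24, (iii) pp. 25–26, (v) pp. 27–29; *IUT III* (RIMS ms May 2020) Cor. 3.12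
proof Step (x) p. 181 (reading (P): the log-volume of the hull of ONE (Ind1)×(Ind2)-image).

The per-image twin (plan R-g8-4 (c)) of abc-iut-S3's junction `PointDict.hullEstimateOf_BIII_of_towerFacts`
(LDHGenuineTowerArith): S-a is replaced by abc-iut-S7's `DHData.hullEstimatePerImageOf_ofInput_explicit`
(LDHGenuinePerImageExplicit: the Step (v) constant for EVERY genuine input, since a slot image carries the theta value
at the last slot `i† = j` only), so the slot-constancy clause (δ) `hconst` of the (U)-junction is DROPPED; the tower
arithmetic (ii)(iii) is composed BY NAME exactly as in the (U)-junction: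
`A ≤ log(𝔡^K)` (abc-iut-S1 `sum_dite_localDegree_mul_differentOrd_le_ndeg`) `≤ log-diff + log 𝔣 + log(2^{a+1}·3^3·5^2)
+ 2·log l` (abc-iut-L5-t15 `Cor22.ndeg_differentDivisor_add_logCondOver_le_pow`) `≤ … + 21` (`a ≤ 14`);
`B ≤ 2·d_mod·(log-diff + log 𝔣) + log(2·3·5·l)` (abc-iut-S3 `sum_log_supportPrimes_le` over abc-iut-L5-t15
`ramified_place_descends_of_not_dvd`); `C_N ≤ π(N)`; abc-iut-S3 `Cor22.deltaK_le_BIII_of_le21`.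

* `PointDict.hullEstimatePerImageOf_BIII_of_towerFacts` — the twin with abc-iut-S3's hypothesis bundle `H` MINUS (δ):
  (α) Galois/degree facts, (β) `hKgood`/`hKbad`/`hFgood`/`hFtame`, (γ) the (R4)-shape e-term input (`e_mod := d_mod`):
  `T.HullEstimatePerImageOf (B_III P l)` (exact registered bytes of `B_III`);
* `PointDict.hullEstimatePerImageOf_BIII_of_R4` — (α)(β) DISCHARGED for every datum by abc-iut-S-d1's
  `Cor22.ThetaVolumeDatumAt.towerFacts` (GenuineTowerFacts): `T.HullEstimatePerImageOf (B_III P l)` from the (R4)-shape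
  input `hR4` ALONE — the one remaining hypothesis of the route edge (ii′-P) at a datum (abc-iut-S1's e-term:
  `PlaceSection.R4_localFieldFamily_abs` + the two-root inertia lemma, plan R-g8-2 (α));
  `…_of_R4_iotaForm` — the same with `hR4` in abc-iut-S1's `ι`-form `3 + log e ≤ 4·ι_p·log(d*·l)`;
* `PointDict.hullVolumePerImageAtDatum_BIII_of_towerFacts` / `…_of_R4` / `…_of_R4_iotaForm` — the `∀ T` forms:
  `Cor22.HullVolumePerImageAtDatum P l (B_III P l)`, i.e. the CONCLUSION of `stub_hullVolumePerImage` at an admissible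
  `(P, l)`, `l ≥ 7`, modulo `hR4` at every datum.
[cite: Mochizuki2012, IUTchIV Thm. 1.10 proof Steps (ii)–(v) p. 24–29] [cite: Mochizuki2012, IUTchIII Cor. 3.12 proof
Step (x) p. 181] [claim: Mochizuki2012, status: disputed] for every IUT quotation. HONEST SCOPE: reading (P) is ONE of the
two typed readings of "−|log(Θ)|" (VERDICT RISK 7; ref-b locator verdict 07:00Z); nothing here asserts (γ), Cor. 3.12 in
either reading, or [IUTchIV] Thm. 1.10; (ii′-P) is the computable half only. typed ≠ proved.
-/

noncomputable section

namespace Summit.ABC.IUTFork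

open Literature.IUT.HodgeTheaters Literature.IUT.LogVolume NumberField IsDedekindDomain
open Literature.NumberTheory.DiophantineGeometry.GenEll
open scoped Nat.Prime

namespace PointDict

variable {P : NFPoint} {l : ℕ}

/-- `log((2^12·3^3·5·d)·l) ≥ 0` for `d, l ≥ 1`. [cite: Mochizuki2012, IUTchIV Thm. 1.10 p. 22] -/
private theorem log_dstar_mul_nonneg' {d l : ℕ} (hd : 1 ≤ d) (hl : 1 ≤ l) :
    0 ≤ Real.log (((2 ^ 12 * 3 ^ 3 * 5 * d : ℕ) : ℝ) * l) := by
  apply Real.log_nonneg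
  have h1 : (1 : ℝ) ≤ ((2 ^ 12 * 3 ^ 3 * 5 * d : ℕ) : ℝ) := by exact_mod_cast (by nlinarith : 1 ≤ 2 ^ 12 * 3 ^ 3 * 5 * d)
  have h2 : (1 : ℝ) ≤ (l : ℝ) := by exact_mod_cast hl
  nlinarith

/-- `log(2^{a+1}·3^3·5^2) ≤ 21` for `a ≤ 14` (print's `a = 10`; the cell's reading v3 needs `a ≤ 13`).
[cite: Mochizuki2012, IUTchIV Thm. 1.10 proof Step (ii) p. 24] -/
private theorem log_two_pow_succ_le_of_le_fourteen' {a : ℕ} (ha : a ≤ 14) :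
    Real.log (2 ^ (a + 1) * 3 ^ 3 * 5 ^ 2) ≤ 21 := by
  have h15 : Real.log (2 ^ 15 * 3 ^ 3 * 5 ^ 2) ≤ 21 := by
    have h2 : Real.log 2 ≤ 0.6931471808 := Real.log_two_lt_d9.le
    have h3 : Real.log 3 ≤ 2 := by
      have := Real.log_le_sub_one_of_pos (show (0 : ℝ) < 3 by norm_num); linarith
    have he := Real.exp_one_gt_d9
    have h5' : (5 : ℝ) ≤ Real.exp 2 := by
      have : Real.exp 2 = Real.exp 1 * Real.exp 1 := by rw [← Real.exp_add]; norm_num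
      rw [this]; nlinarith
    have h5 : Real.log 5 ≤ 2 := by
      calc Real.log 5 ≤ Real.log (Real.exp 2) := Real.log_le_log (by norm_num) h5'
        _ = 2 := Real.log_exp 2
    rw [Real.log_mul (by norm_num) (by norm_num), Real.log_mul (by norm_num) (by norm_num),
      Real.log_pow, Real.log_pow, Real.log_pow]
    push_cast
    linarith
  refine le_trans (Real.log_le_log (by positivity) ?_) h15
  have h : (2 : ℝ) ^ (a + 1) ≤ 2 ^ 15 := pow_le_pow_right₀ (by norm_num) (by omega)
  nlinarith

/-- The datum's per-image hull estimate is monotone in the constant. [cite: DupuyHilado2025, §4.12] -/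
theorem hullEstimatePerImageOf_mono (T : Cor22.ThetaVolumeDatumAt P l) {δ δ' : ℝ} (h : T.HullEstimatePerImageOf δ)
    (hle : δ ≤ δ') : T.HullEstimatePerImageOf δ' := by
  letI := T.instFieldF; letI := T.instNumberFieldF; letI := T.instFieldK; letI := T.instNumberFieldK
  letI := T.instAlgebraK
  unfold Cor22.ThetaVolumeDatumAt.HullEstimatePerImageOf at h ⊢
  exact T.I.hullEstimatePerImageOf_mono h hle

/-- **S-b AT THE GENUINE DATUM IN READING (P): `T.HullEstimatePerImageOf (B_III P l)` from abc-iut-S7's per-image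
Step (v) constant and the tower facts** — the per-image twin of abc-iut-S3's `hullEstimateOf_BIII_of_towerFacts` with
the slot-constancy clause (δ) dropped. For `λ ∈ U_X` (minimally presented), a prime `l ≥ 7`, a genuine Θ-volume datum
`T` at `(P, l)`, and the hypothesis `H` bundling (α) `F/F_tpd`, `K/F`, `K/F_mod` Galois, `[F:F_tpd] ∣ 2^a·3^2·5`
(`a ≤ 14`), `[K:F] ∣ l(l−1)²(l+1)`; (β) `hKgood`/`hKbad`/`hFgood`/`hFtame` ([IUTchIV] Prop. 1.8 (vi)(vii) instance
shapes); (γ) the (R4)-shape e-term input with `e*_mod := d*_mod`: `T.HullEstimatePerImageOf (B_III P l)`.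
[cite: Mochizuki2012, IUTchIV Thm. 1.10 proof Steps (ii)–(v) p. 24–29] [cite: Mochizuki2012, IUTchIII Cor. 3.12 proof
Step (x) p. 181] [claim: Mochizuki2012, status: disputed] -/
theorem hullEstimatePerImageOf_BIII_of_towerFacts (T : Cor22.ThetaVolumeDatumAt P l) (hP : P ∈ UP) (hl : l.Prime)
    (h7 : 7 ≤ l)
    (H : letI := T.instFieldF; letI := T.instNumberFieldF; letI := T.instAlgebraF; letI := T.instFieldK
      letI := T.instNumberFieldK; letI := T.instAlgebraK; letI := T.instFieldFbar; letI := T.instAlgebraFbar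
      letI := T.instAlgebraKFbar; letI := T.instIsElliptic
      IsGalois P.F T.F ∧ IsGalois T.F T.K ∧ IsGalois (fieldOfModuli T.E) T.K ∧
      (∃ a : ℕ, a ≤ 14 ∧ Module.finrank P.F T.F ∣ 2 ^ a * 3 ^ 2 * 5) ∧
      Module.finrank T.F T.K ∣ l * (l - 1) ^ 2 * (l + 1) ∧
      (∀ u : HeightOneSpectrum (𝓞 T.K), residueChar T.K u ≠ l →
        finBelow P.F T.F (finBelow T.F T.K u) ∉ Cor22.badPlaces P → u.asIdeal.ramificationIdx (𝓞 T.F) = 1) ∧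
      (∀ u : HeightOneSpectrum (𝓞 T.K), residueChar T.K u ≠ l →
        finBelow P.F T.F (finBelow T.F T.K u) ∈ Cor22.badPlaces P →
          ¬ residueChar T.K u ∣ u.asIdeal.ramificationIdx (𝓞 T.F)) ∧
      (∀ w : HeightOneSpectrum (𝓞 T.F), residueChar T.F w ∉ ({2, 3, 5} : Finset ℕ) →
        finBelow P.F T.F w ∉ Cor22.badPlaces P → w.asIdeal.ramificationIdx (𝓞 P.F) = 1) ∧
      (∀ w : HeightOneSpectrum (𝓞 T.F), residueChar T.F w ∉ ({2, 3, 5} : Finset ℕ) →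
        ¬ residueChar T.F w ∣ w.asIdeal.ramificationIdx (𝓞 P.F)) ∧
      (∀ (p : ℕ) [hp : Fact p.Prime], p ∈ T.I.supportPrimes → ∀ v : placesOver (fieldOfModuli T.E) p,
        p - 2 < absRamificationIdx p ((T.I.σ.localFieldFamily p hp.out).k v) →
          p ≤ 2 ^ 12 * 3 ^ 3 * 5 * Cor22.dmod P * l ∧
            3 + Real.log (absRamificationIdx p ((T.I.σ.localFieldFamily p hp.out).k v)) ≤
              4 * Real.log (((2 ^ 12 * 3 ^ 3 * 5 * Cor22.dmod P : ℕ) : ℝ) * l))) :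
    T.HullEstimatePerImageOf (((l : ℝ) + 1) / 4 * ((1 + 12 * (Cor22.dmod P : ℝ) / l)
      * (P.logDiff + Cor22.logCondAvoid P {2, l}) + 2 * Real.log l + 52
        + 20 / 3 * Real.log (((2 ^ 12 * 3 ^ 3 * 5 * Cor22.dmod P : ℕ) : ℝ) * (l : ℝ))
          * (Nat.primeCounting (2 ^ 12 * 3 ^ 3 * 5 * Cor22.dmod P * l) : ℝ))) := by
  classical
  letI := T.instFieldF; letI := T.instNumberFieldF; letI := T.instAlgebraF; letI := T.instFieldK
  letI := T.instNumberFieldK; letI := T.instAlgebraK; letI := T.instFieldFbar; letI := T.instAlgebraFbar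
  letI := T.instAlgebraKFbar; letI := T.instIsElliptic
  obtain ⟨hGalF, hGalK, hGalMod, ⟨a, ha, hdegF⟩, hdegK, hKgood, hKbad, hFgood, hFtame, hR4⟩ := H
  haveI := hGalF; haveI := hGalK; haveI := hGalMod
  -- the composite algebra `F_tpd → F → K`
  letI : Algebra P.F T.K := ((algebraMap T.F T.K).comp (algebraMap P.F T.F)).toAlgebra
  haveI : IsScalarTower P.F T.F T.K := IsScalarTower.of_algebraMap_eq fun _ => rfl
  have hfb : ∀ u : HeightOneSpectrum (𝓞 T.K), finBelow P.F T.F (finBelow T.F T.K u) = finBelow P.F T.K u :=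
    fun u => finBelow_finBelow P.F T.F T.K u
  have h5 : 5 ≤ l := by omega
  have hl1 : 1 ≤ l := by omega
  have hd : 1 ≤ Cor22.dmod P := Cor22.dmod_pos P
  have hXl : ((T.I.X.l : ℕ) : ℝ) = (l : ℝ) := by exact_mod_cast T.isVolumeInputOf.l_eq
  -- S-a in reading (P) (abc-iut-S7): the per-image hull estimate with the explicit Step (v) constant, EVERY input,
  -- `N = d*·l`, `l* = log(d*·l)`, NO slot-constancy
  have hlmod := log_dstar_mul_nonneg' hd hl1
  have h0 := DHData.hullEstimatePerImageOf_ofInput_explicit T.I (2 ^ 12 * 3 ^ 3 * 5 * Cor22.dmod P * l) hlmod hR4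
  -- (ii-K) for `A`: abc-iut-S1 (section sum ≤ `log 𝔡^K`) then abc-iut-L5-t15 (tower bound), then `a ≤ 14`
  have hprimes : ∀ p ∈ T.I.supportPrimes, p.Prime := fun p hp => T.I.prime_of_mem_supportPrimes hp
  have hA1 := sum_dite_localDegree_mul_differentOrd_le_ndeg (fieldOfModuli T.E) T.K T.I.σ T.I.supportPrimes hprimes
  have hA2 := Cor22.ndeg_differentDivisor_add_logCondOver_le_pow P hl h7 a T.F T.K hdegF hdegK
    (fun u hu hb => hKgood u hu (by rwa [hfb u])) (fun u hu hb => hKbad u hu (by rwa [hfb u])) hFgood hFtame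
  have hA3 := Cor22.logCondOver_nonneg P {2, l} T.K
  have hA4 := log_two_pow_succ_le_of_le_fourteen' ha
  have hA : (∑ p ∈ T.I.supportPrimes, if hp : p.Prime then haveI : Fact p.Prime := ⟨hp⟩
        (∑ v : placesOver (fieldOfModuli T.E) p, (localDegree (fieldOfModuli T.E) v.1 : ℝ) *
          differentOrd p ((T.I.σ.localFieldFamily p hp).k v)) / Module.finrank ℚ (fieldOfModuli T.E) * Real.log p
        else 0) ≤ P.logDiff + Cor22.logCondAvoid P {2, l} + 2 * Real.log l + 21 := by
    linarith
  -- (iii) for `B`: abc-iut-S3 `sum_log_supportPrimes_le` over the (D0)-descent (abc-iut-L5-t15) from `hKgood`/`hFgood`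
  have hS : ∀ p ∈ ({2, l} : Finset ℕ), p.Prime := by
    intro p hp
    simp only [Finset.mem_insert, Finset.mem_singleton] at hp
    rcases hp with rfl | rfl
    · exact Nat.prime_two
    · exact hl
  have avoid_of_bad : ∀ v : HeightOneSpectrum (𝓞 P.F), v ∈ Cor22.badPlaces P → residueChar P.F v ≠ 2 →
      residueChar P.F v ≠ l → v ∈ Cor22.badPlacesAvoid P {2, l} := by
    intro v hv h2 hl'
    refine Cor22.mem_badPlacesAvoid_of_residueChar_notMem hS hv ?_
    simp only [Finset.mem_insert, Finset.mem_singleton, not_or]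
    exact ⟨h2, hl'⟩
  have hKunr : ∀ u : HeightOneSpectrum (𝓞 T.K), residueChar T.K u ∉ ({2, 3, 5, l} : Finset ℕ) →
      finBelow P.F T.K u ∉ Cor22.badPlacesAvoid P {2, l} → u.asIdeal.ramificationIdx (𝓞 T.F) = 1 := by
    intro u hp hSu
    simp only [Finset.mem_insert, Finset.mem_singleton, not_or] at hp
    refine hKgood u hp.2.2.2 fun hb => hSu ?_
    rw [hfb u] at hb
    have hres : residueChar P.F (finBelow P.F T.K u) = residueChar T.K u := residueChar_finBelow (F := P.F) u
    exact avoid_of_bad _ hb (by rw [hres]; exact hp.1) (by rw [hres]; exact hp.2.2.2)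
  have hFunr : ∀ w : HeightOneSpectrum (𝓞 T.F), residueChar T.F w ∉ ({2, 3, 5, l} : Finset ℕ) →
      finBelow P.F T.F w ∉ Cor22.badPlacesAvoid P {2, l} → w.asIdeal.ramificationIdx (𝓞 P.F) = 1 := by
    intro w hp hSw
    simp only [Finset.mem_insert, Finset.mem_singleton, not_or] at hp
    refine hFgood w (by simp only [Finset.mem_insert, Finset.mem_singleton, not_or]; exact ⟨hp.1, hp.2.1, hp.2.2.1⟩)
      fun hb => hSw ?_
    have hres : residueChar P.F (finBelow P.F T.F w) = residueChar T.F w := residueChar_finBelow (F := P.F) w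
    exact avoid_of_bad _ hb (by rw [hres]; exact hp.1) (by rw [hres]; exact hp.2.2.2)
  have hD0 : ∀ u : HeightOneSpectrum (𝓞 T.K), 2 ≤ u.asIdeal.ramificationIdx ℤ → ¬ residueChar T.K u ∣ 2 * 3 * 5 * l →
      finBelow P.F T.F (finBelow T.F T.K u) ∈ Cor22.badPlacesAvoid P {2, l} ∨
        2 ≤ (finBelow P.F T.F (finBelow T.F T.K u)).asIdeal.ramificationIdx ℤ := by
    intro u hram hndvd
    rw [hfb u]
    exact ramified_place_descends_of_not_dvd P.F T.F T.K (Cor22.badPlacesAvoid P {2, l}) hKunr hFunr u hram hndvd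
  have hB := T.sum_log_supportPrimes_le hP hl.pos hD0
  -- `C ≤ π(d*·l)`
  have hC : (((T.I.supportPrimes.filter (· ≤ 2 ^ 12 * 3 ^ 3 * 5 * Cor22.dmod P * l)).card : ℕ) : ℝ) ≤
      (π (2 ^ 12 * 3 ^ 3 * 5 * Cor22.dmod P * l) : ℝ) := by
    exact_mod_cast Cor22.card_filter_le_primeCounting T.I.supportPrimes hprimes _
  -- tower arithmetic: `δ_explicit ≤ B_III(P, l)` by `deltaK_le_BIII_of_le21` (Steps (ii)(iii))
  have hδ := Cor22.deltaK_le_BIII_of_le21 (P := P) hl h5 hd le_rfl hA hB hC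
  refine hullEstimatePerImageOf_mono T h0 (le_trans (le_of_eq ?_) hδ)
  have e : (((2 ^ 12 * 3 ^ 3 * 5 * Cor22.dmod P : ℕ) : ℝ) * l) = ((2 : ℝ) ^ 12 * 3 ^ 3 * 5 * (Cor22.dmod P) * l) := by
    push_cast; ring
  rw [hXl, e]

/-- **(ii′-P) AT A DATUM MODULO THE e-TERM ONLY: `T.HullEstimatePerImageOf (B_III P l)` from the (R4)-shape input
`hR4` alone** — the Galois/degree facts (α) and the Prop. 1.8 (vi)(vii) instance forms (β) of the datum's tower
`F_tpd ⊆ F ⊆ K` are DISCHARGED by abc-iut-S-d1's `Cor22.ThetaVolumeDatumAt.towerFacts` (reading v3, `F ⊆ F‡`), and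
no slot-constancy is needed in reading (P). The remaining hypothesis is abc-iut-S1's e-term (R4) for the genuine
completions `K_{v̲}` with print's `e*_mod = 2^12·3^3·5·d_mod` (`PlaceSection.R4_localFieldFamily_abs` + the two-root
inertia lemma, plan R-g8-2 (α)). [cite: Mochizuki2012, IUTchIV Thm. 1.10 proof Steps (ii)–(v) p. 24–29]
[cite: Mochizuki2012, IUTchIII Cor. 3.12 proof Step (x) p. 181] [claim: Mochizuki2012, status: disputed] -/
theorem hullEstimatePerImageOf_BIII_of_R4 (T : Cor22.ThetaVolumeDatumAt P l) (hP : P ∈ UP) (hl : l.Prime) (h7 : 7 ≤ l)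
    (hR4 : letI := T.instFieldF; letI := T.instNumberFieldF; letI := T.instAlgebraF; letI := T.instFieldK
      letI := T.instNumberFieldK; letI := T.instAlgebraK; letI := T.instIsElliptic
      ∀ (p : ℕ) [hp : Fact p.Prime], p ∈ T.I.supportPrimes → ∀ v : placesOver (fieldOfModuli T.E) p,
        p - 2 < absRamificationIdx p ((T.I.σ.localFieldFamily p hp.out).k v) →
          p ≤ 2 ^ 12 * 3 ^ 3 * 5 * Cor22.dmod P * l ∧
            3 + Real.log (absRamificationIdx p ((T.I.σ.localFieldFamily p hp.out).k v)) ≤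
              4 * Real.log (((2 ^ 12 * 3 ^ 3 * 5 * Cor22.dmod P : ℕ) : ℝ) * l)) :
    T.HullEstimatePerImageOf (((l : ℝ) + 1) / 4 * ((1 + 12 * (Cor22.dmod P : ℝ) / l)
      * (P.logDiff + Cor22.logCondAvoid P {2, l}) + 2 * Real.log l + 52
        + 20 / 3 * Real.log (((2 ^ 12 * 3 ^ 3 * 5 * Cor22.dmod P : ℕ) : ℝ) * (l : ℝ))
          * (Nat.primeCounting (2 ^ 12 * 3 ^ 3 * 5 * Cor22.dmod P * l) : ℝ))) := by
  letI := T.instFieldF; letI := T.instNumberFieldF; letI := T.instAlgebraF; letI := T.instFieldK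
  letI := T.instNumberFieldK; letI := T.instAlgebraK; letI := T.instFieldFbar; letI := T.instAlgebraFbar
  letI := T.instAlgebraKFbar; letI := T.instIsElliptic
  obtain ⟨h1, h2, h3, h4, h5, h6, h7', h8, h9⟩ := T.towerFacts hP.1
  exact hullEstimatePerImageOf_BIII_of_towerFacts T hP hl h7 ⟨h1, h2, h3, h4, h5, h6, h7', h8, h9, hR4⟩

/-- **The same with the e-term input in abc-iut-S1's `ι`-form** `p − 2 < e(K_{v̲}) ⟹ 3 + log e(K_{v̲}) ≤
4·ι_p·log(d*·l)`, `ι_p = (p ≤ d*·l ? 1 : 0)` — the literal output shape of `PlaceSection.R4_localFieldFamily(_abs/_param)`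
with `N := 2^12·3^3·5·d_mod` (abc-iut-c312-d1 `DHData.r4_of_iotaForm`: the `ι`-form forces `ι_p = 1`).
[cite: Mochizuki2012, IUTchIV Thm. 1.10 proof Step (iii) (R4) p. 26, Step (v) p. 28] [claim: Mochizuki2012, status: disputed] -/
theorem hullEstimatePerImageOf_BIII_of_R4_iotaForm (T : Cor22.ThetaVolumeDatumAt P l) (hP : P ∈ UP) (hl : l.Prime)
    (h7 : 7 ≤ l)
    (hR4 : letI := T.instFieldF; letI := T.instNumberFieldF; letI := T.instAlgebraF; letI := T.instFieldK
      letI := T.instNumberFieldK; letI := T.instAlgebraK; letI := T.instIsElliptic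
      ∀ (p : ℕ) [hp : Fact p.Prime], p ∈ T.I.supportPrimes → ∀ v : placesOver (fieldOfModuli T.E) p,
        p - 2 < absRamificationIdx p ((T.I.σ.localFieldFamily p hp.out).k v) →
          3 + Real.log (absRamificationIdx p ((T.I.σ.localFieldFamily p hp.out).k v)) ≤
            4 * (if p ≤ 2 ^ 12 * 3 ^ 3 * 5 * Cor22.dmod P * l then (1 : ℝ) else 0) *
              Real.log (((2 ^ 12 * 3 ^ 3 * 5 * Cor22.dmod P : ℕ) : ℝ) * l)) :
    T.HullEstimatePerImageOf (((l : ℝ) + 1) / 4 * ((1 + 12 * (Cor22.dmod P : ℝ) / l)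
      * (P.logDiff + Cor22.logCondAvoid P {2, l}) + 2 * Real.log l + 52
        + 20 / 3 * Real.log (((2 ^ 12 * 3 ^ 3 * 5 * Cor22.dmod P : ℕ) : ℝ) * (l : ℝ))
          * (Nat.primeCounting (2 ^ 12 * 3 ^ 3 * 5 * Cor22.dmod P * l) : ℝ))) := by
  letI := T.instFieldF; letI := T.instNumberFieldF; letI := T.instAlgebraF; letI := T.instFieldK
  letI := T.instNumberFieldK; letI := T.instAlgebraK; letI := T.instIsElliptic
  refine hullEstimatePerImageOf_BIII_of_R4 T hP hl h7 fun p hp hpT v hv => ?_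
  have ecast : Real.log ((2 : ℝ) ^ 12 * 3 ^ 3 * 5 * (Cor22.dmod P) * l) =
      Real.log (((2 ^ 12 * 3 ^ 3 * 5 * Cor22.dmod P : ℕ) : ℝ) * l) := by
    push_cast; ring_nf
  have h := DHData.r4_of_iotaForm (hR4 p hpT v) hv
  rw [ecast] at h
  exact h

/-- **The `∀ T` form of the twin: `Cor22.HullVolumePerImageAtDatum P l (B_III P l)`** — the conclusion of
`stub_hullVolumePerImage` at an admissible `(P, l)`, `l ≥ 7`, from abc-iut-S3's hypothesis bundle minus (δ) at every datum.
[cite: Mochizuki2012, IUTchIV Thm. 1.10 proof Steps (ii)–(v) p. 24–29] [claim: Mochizuki2012, status: disputed] -/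
theorem hullVolumePerImageAtDatum_BIII_of_towerFacts (hP : P ∈ UP) (hl : l.Prime) (h7 : 7 ≤ l)
    (H : ∀ T : Cor22.ThetaVolumeDatumAt P l,
      letI := T.instFieldF; letI := T.instNumberFieldF; letI := T.instAlgebraF; letI := T.instFieldK
      letI := T.instNumberFieldK; letI := T.instAlgebraK; letI := T.instFieldFbar; letI := T.instAlgebraFbar
      letI := T.instAlgebraKFbar; letI := T.instIsElliptic
      IsGalois P.F T.F ∧ IsGalois T.F T.K ∧ IsGalois (fieldOfModuli T.E) T.K ∧
      (∃ a : ℕ, a ≤ 14 ∧ Module.finrank P.F T.F ∣ 2 ^ a * 3 ^ 2 * 5) ∧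
      Module.finrank T.F T.K ∣ l * (l - 1) ^ 2 * (l + 1) ∧
      (∀ u : HeightOneSpectrum (𝓞 T.K), residueChar T.K u ≠ l →
        finBelow P.F T.F (finBelow T.F T.K u) ∉ Cor22.badPlaces P → u.asIdeal.ramificationIdx (𝓞 T.F) = 1) ∧
      (∀ u : HeightOneSpectrum (𝓞 T.K), residueChar T.K u ≠ l →
        finBelow P.F T.F (finBelow T.F T.K u) ∈ Cor22.badPlaces P →
          ¬ residueChar T.K u ∣ u.asIdeal.ramificationIdx (𝓞 T.F)) ∧
      (∀ w : HeightOneSpectrum (𝓞 T.F), residueChar T.F w ∉ ({2, 3, 5} : Finset ℕ) →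
        finBelow P.F T.F w ∉ Cor22.badPlaces P → w.asIdeal.ramificationIdx (𝓞 P.F) = 1) ∧
      (∀ w : HeightOneSpectrum (𝓞 T.F), residueChar T.F w ∉ ({2, 3, 5} : Finset ℕ) →
        ¬ residueChar T.F w ∣ w.asIdeal.ramificationIdx (𝓞 P.F)) ∧
      (∀ (p : ℕ) [hp : Fact p.Prime], p ∈ T.I.supportPrimes → ∀ v : placesOver (fieldOfModuli T.E) p,
        p - 2 < absRamificationIdx p ((T.I.σ.localFieldFamily p hp.out).k v) →
          p ≤ 2 ^ 12 * 3 ^ 3 * 5 * Cor22.dmod P * l ∧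
            3 + Real.log (absRamificationIdx p ((T.I.σ.localFieldFamily p hp.out).k v)) ≤
              4 * Real.log (((2 ^ 12 * 3 ^ 3 * 5 * Cor22.dmod P : ℕ) : ℝ) * l))) :
    Cor22.HullVolumePerImageAtDatum P l (((l : ℝ) + 1) / 4 * ((1 + 12 * (Cor22.dmod P : ℝ) / l)
      * (P.logDiff + Cor22.logCondAvoid P {2, l}) + 2 * Real.log l + 52
        + 20 / 3 * Real.log (((2 ^ 12 * 3 ^ 3 * 5 * Cor22.dmod P : ℕ) : ℝ) * (l : ℝ))
          * (Nat.primeCounting (2 ^ 12 * 3 ^ 3 * 5 * Cor22.dmod P * l) : ℝ))) :=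
  fun T => hullEstimatePerImageOf_BIII_of_towerFacts T hP hl h7 (H T)

/-- **(ii′-P) AT `(P, l)` MODULO THE e-TERM ONLY: `Cor22.HullVolumePerImageAtDatum P l (B_III P l)` from the (R4)-shape
input at every datum** — (α)(β) discharged by `towerFacts`; this is the conclusion of the registered stub
`stub_hullVolumePerImage` at an admissible `(P, l)` with `l ≥ 7` (`7 ≤ l` follows from `Cor22.CondP6 P l`, abc-iut-c312-8
`seven_le_of_condP6`), so that the stub closes the minute `hR4` is a theorem for every datum.
[cite: Mochizuki2012, IUTchIV Thm. 1.10 proof Steps (ii)–(v) p. 24–29] [claim: Mochizuki2012, status: disputed] -/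
theorem hullVolumePerImageAtDatum_BIII_of_R4 (hP : P ∈ UP) (hl : l.Prime) (h7 : 7 ≤ l)
    (hR4 : ∀ T : Cor22.ThetaVolumeDatumAt P l,
      letI := T.instFieldF; letI := T.instNumberFieldF; letI := T.instAlgebraF; letI := T.instFieldK
      letI := T.instNumberFieldK; letI := T.instAlgebraK; letI := T.instIsElliptic
      ∀ (p : ℕ) [hp : Fact p.Prime], p ∈ T.I.supportPrimes → ∀ v : placesOver (fieldOfModuli T.E) p,
        p - 2 < absRamificationIdx p ((T.I.σ.localFieldFamily p hp.out).k v) →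
          p ≤ 2 ^ 12 * 3 ^ 3 * 5 * Cor22.dmod P * l ∧
            3 + Real.log (absRamificationIdx p ((T.I.σ.localFieldFamily p hp.out).k v)) ≤
              4 * Real.log (((2 ^ 12 * 3 ^ 3 * 5 * Cor22.dmod P : ℕ) : ℝ) * l)) :
    Cor22.HullVolumePerImageAtDatum P l (((l : ℝ) + 1) / 4 * ((1 + 12 * (Cor22.dmod P : ℝ) / l)
      * (P.logDiff + Cor22.logCondAvoid P {2, l}) + 2 * Real.log l + 52
        + 20 / 3 * Real.log (((2 ^ 12 * 3 ^ 3 * 5 * Cor22.dmod P : ℕ) : ℝ) * (l : ℝ))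
          * (Nat.primeCounting (2 ^ 12 * 3 ^ 3 * 5 * Cor22.dmod P * l) : ℝ))) :=
  fun T => hullEstimatePerImageOf_BIII_of_R4 T hP hl h7 (hR4 T)

/-- **The `∀ T` form with the e-term input in abc-iut-S1's `ι`-form.**
[cite: Mochizuki2012, IUTchIV Thm. 1.10 proof Step (iii) (R4) p. 26, Step (v) p. 28] [claim: Mochizuki2012, status: disputed] -/
theorem hullVolumePerImageAtDatum_BIII_of_R4_iotaForm (hP : P ∈ UP) (hl : l.Prime) (h7 : 7 ≤ l)
    (hR4 : ∀ T : Cor22.ThetaVolumeDatumAt P l,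
      letI := T.instFieldF; letI := T.instNumberFieldF; letI := T.instAlgebraF; letI := T.instFieldK
      letI := T.instNumberFieldK; letI := T.instAlgebraK; letI := T.instIsElliptic
      ∀ (p : ℕ) [hp : Fact p.Prime], p ∈ T.I.supportPrimes → ∀ v : placesOver (fieldOfModuli T.E) p,
        p - 2 < absRamificationIdx p ((T.I.σ.localFieldFamily p hp.out).k v) →
          3 + Real.log (absRamificationIdx p ((T.I.σ.localFieldFamily p hp.out).k v)) ≤
            4 * (if p ≤ 2 ^ 12 * 3 ^ 3 * 5 * Cor22.dmod P * l then (1 : ℝ) else 0) *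
              Real.log (((2 ^ 12 * 3 ^ 3 * 5 * Cor22.dmod P : ℕ) : ℝ) * l)) :
    Cor22.HullVolumePerImageAtDatum P l (((l : ℝ) + 1) / 4 * ((1 + 12 * (Cor22.dmod P : ℝ) / l)
      * (P.logDiff + Cor22.logCondAvoid P {2, l}) + 2 * Real.log l + 52
        + 20 / 3 * Real.log (((2 ^ 12 * 3 ^ 3 * 5 * Cor22.dmod P : ℕ) : ℝ) * (l : ℝ))
          * (Nat.primeCounting (2 ^ 12 * 3 ^ 3 * 5 * Cor22.dmod P * l) : ℝ))) :=
  fun T => hullEstimatePerImageOf_BIII_of_R4_iotaForm T hP hl h7 (hR4 T)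

end PointDict

end Summit.ABC.IUTFork

end
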